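/-
Copyright (c) 2026 the pub-hodgecm-mathlib formalisation cell (harness21).  Prover seat hodgecm-mathlib-LH4-p12 (g4), Track A «(D-RAM) FOUR-FRAME», unit U2H, the census leaf
(ρ2b′-X) `stub_U2H_fixedPointCensus_typeTwo_unit0` — RHO2BX-ORDER v1 (payer LH4-p14 (g3)) organ O-W, the W-SIDE ORDER CENSUS (evaluation of (C)'s right-hand side).  2026-09-04.
-/
import Summits.HodgeConjecture.HodgeConjecture.Theorems.F0P3cDyRamToricCensusDefs   -- DEFS leaf (this seat): `IsOrd`, `dualGen`, `levelSet`; brings ★ T4 chain p857156∕067∕040∕021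
import HarnessLib

/-!
# Crux `H413`, line LH4 «(D-RAM) FOUR-FRAME», leaf (ρ2b′-X) — organ O-W: THE W-SIDE ORDER CENSUS.  The `λ`-stable hermitian-SELF-DUAL order lattices of the line model
# are exactly the `λ`-stable members of the LEVEL-ZERO sets `levelSet j 0`, one conductor `j` at a time: `#{Λ = z𝒪_c, λΛ ⊆ Λ, Λ = Λ^#} = Σ_{j ≤ J} [λ ∈ 𝒪_j]·#levelSet(j, 0)`

Cell `hodgecm-mathlib` (D-0151), FLOOR 0, crux H413 = `stmt-HodgeConjecture-24833`, Track A, unit U2H, leaf (ρ2b′-X) (OPEN-CONFIRMED, T18-55); RHO2BX-ORDER v1 organ **O-W** →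
`Theorems/F0P3cDyRamWSideOrderCensus.lean` (this file).  THEOREMS ONLY (no `def`, no instance, no notation, no `sorry`); lane `--supports stmt-HodgeConjecture-24833` (count-neutral).
INPUT: ★ T3-T (C) `Literature.….EllipticPlaneAsFieldLine.ncard_selfDual_fixed_eq_ncard_orderLatt` (p857203 ∕ p857215) turns the AXIS TERM `#{B ⊂ E_w² self-dual, γ₂B = B}` of ★
`UnitaryLatticeTree.ncard_selfDual_fixed_axis_eq` into `#{Λ ≤ M | Λ = z·𝒪_c ∧ lam·Λ ⊆ Λ ∧ Λ = Λ^#}`.  THIS FILE evaluates that set in the DEFS-leaf vocabulary: (W1) for an order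
lattice `Λ = x₀·𝒪_c`, «`Λ` equals its hermitian dual» ⟺ `y := dualGen ∈ 𝒪_c ∧ |y| = 1` (★ T4c integrality + depth-at-`μ = 1` + `𝒪_c` is closed under inverting its elements of value
`1`); (W2) with `0 < |ϖE| < 1` this is «INTEGRAL, GRAM-PRIMITIVE, LEVEL `0`» — membership in `levelSet j 0` for the `j` with `|c| = |ϖE|^j`; (W3) `lam`-stability is `lam ∈ 𝒪_j` (★
multiplier criterion) and two level sets of different conductor are DISJOINT (the conductor of an order lattice is read on its multiplier ring); (W4) **the COUNT**: for any `J` past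
the last conductor containing `lam`, `#{Λ | order lattice ∧ lam·Λ ⊆ Λ ∧ self-dual} = Σ_{j ≤ J} (if lam ∈ 𝒪_j then #levelSet(j, 0) else 0)` (finite level sets).  The values
`#levelSet(j, 0)` are the `a = 0` rows of T5a ∕ T5b ∕ T5c (LH4-p08 (g4), F0P3-p01 (g32), LH4-p06 (g4)).
HONEST LABEL: count-neutral; nothing here moves the books; HC_CM is proved only modulo the 7 printed citations (2 remaining named inputs: hLiu418 = `stmt-HodgeConjecture-24832`, h413 =
`stmt-HodgeConjecture-24833`) until rung 0 closes.

FRAME (explicit binders, ★ T4 ∕ DEFS-leaf currency): one field `K` = model of `M` with `Valued K ℤᵐ⁰`; `ρ Θ : K →+* K` (`hρρ hvρ hΘΘ hΘρ hvΘ`); `α` (`hα : ρα ≠ α`, `hα1 : |α| ≤ 1`,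
`hint`); `ϖE` (`ρϖE = ϖE`, `0 < |ϖE| < 1`) and the E-VALUE hypothesis `hEval : ρ c = c → c ≠ 0 → |c| ≤ 1 → ∃ n : ℕ, |c| = |ϖE|^n` (conductors are powers of `ϖE` up to value);
`h ≠ 0`; `lam` with `|lam| = 1`.

## References
* [Kottwitz1986BaseChangeUnits] R. E. Kottwitz, *Base change for unit elements of Hecke algebras*, Compositio Math. 60 (1986), §1 pp. 240–241 (fixed-lattice counts).
* [Flicker1998UnitaryFL] Y. Z. Flicker, *Elementary proof of the fundamental lemma for a unitary group*, Canad. J. Math. 50 (1998), p. 84 REMARK (Mars: `H = ⊔_j T_H r_j K_H`, lattices `z·R_E(j)`).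
* [Jacobowitz1962] R. Jacobowitz, *Hermitian forms over local fields*, Amer. J. Math. 84 (1962), §4, §7 (unimodular hermitian lattices).
-/

set_option autoImplicit false

noncomputable section

open WithZero
open scoped Classical
open Literature.NumberTheory.LocalFields.QuadraticOrder
open Summit.HodgeConjecture.HodgeConjecture.Cruxes.H413.F0P3cDyRamToricCensusDefs

namespace Summit.HodgeConjecture.HodgeConjecture.Cruxes.H413.F0P3cDyRamWSideOrderCensus

variable {K : Type*} [Field K] [Valued K ℤᵐ⁰] {ρ Θ : K →+* K} {α : K}

/-! ## §1 (W1) Self-duality of an order lattice in `y`-currency -/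

/-- An order is closed under inverting its elements of value `1`: `IsOrd c y ∧ |y| = 1 ⇒ IsOrd c y⁻¹` (`y⁻¹ = ρy·(yρy)⁻¹`, `yρy` a fixed unit). [cite: Jacobowitz1962, §4] -/
theorem isOrd_inv_of_v_eq_one (hρρ : ∀ x, ρ (ρ x) = x) (hvρ : ∀ x, Valued.v (ρ x) = Valued.v x) {c y : K} (hy : IsOrd ρ α c y) (hy1 : Valued.v y = 1) :
    IsOrd ρ α c y⁻¹ := by
  have hy0 : y ≠ 0 := fun h0 => by rw [h0, map_zero] at hy1; exact zero_ne_one hy1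
  have hρy0 : ρ y ≠ 0 := (map_ne_zero ρ).2 hy0
  have hrew : y⁻¹ = ρ y * (y * ρ y)⁻¹ := by field_simp
  rw [IsOrd, hrew]
  refine mul_mem_order hvρ (map_mem_order hρρ hvρ hy) (mem_order_of_fixed c ?_ ?_)
  · rw [map_inv₀, map_mul_map_self hρρ]
  · rw [map_inv₀, map_mul, hvρ, hy1, mul_one, inv_one]

/-- **(W1) SELF-DUALITY IN `y`-CURRENCY**: for `Λ = x₀·𝒪_c` (`x₀, h, c ≠ 0`), `Λ` equals its hermitian dual for `Tr(h·Θ(a)·b)` iff `y = dualGen ∈ 𝒪_c` and `|y| = 1`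
(`⊆`: ★ T4c integrality; `⊇` = the depth clause at `μ = 1`: `y⁻¹ ∈ 𝒪_c`). [cite: Jacobowitz1962, §4, §7] -/
theorem forall_herm_iff_mem_iff_isOrd_and_v_eq_one (hρρ : ∀ x, ρ (ρ x) = x) (hvρ : ∀ x, Valued.v (ρ x) = Valued.v x) (hα : ρ α ≠ α) (hα1 : Valued.v α ≤ 1)
    (hint : ∀ z : K, Valued.v z ≤ 1 → Valued.v ((z - ρ z) / (α - ρ α)) ≤ 1)
    (hΘΘ : ∀ x, Θ (Θ x) = x) (hΘρ : ∀ x, Θ (ρ x) = ρ (Θ x)) (hvΘ : ∀ x, Valued.v (Θ x) = Valued.v x)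
    {c : K} (hc : ρ c = c) (hc0 : c ≠ 0) (hc1 : Valued.v c ≤ 1) {h : K} (hh : h ≠ 0) {Λ : AddSubgroup K} {x₀ : K} (hx₀ : x₀ ≠ 0)
    (hΛ : ∀ x, x ∈ Λ ↔ ∃ z, IsOrd ρ α c z ∧ x = x₀ * z) :
    (∀ m, (∀ a ∈ Λ, Valued.v (h * Θ a * m + ρ (h * Θ a * m)) ≤ 1) ↔ m ∈ Λ) ↔
      (IsOrd ρ α c (dualGen ρ Θ α c h x₀) ∧ Valued.v (dualGen ρ Θ α c h x₀) = 1) := by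
  have hd : α - ρ α ≠ 0 := sub_ne_zero.2 (Ne.symm hα)
  have hΘx₀ : Θ x₀ ≠ 0 := (map_ne_zero Θ).2 hx₀
  have hy0 : dualGen ρ Θ α c h x₀ ≠ 0 := by
    rw [dualGen]; exact mul_ne_zero (mul_ne_zero hh (mul_ne_zero hx₀ hΘx₀)) (mul_ne_zero hc0 hd)
  -- integrality ⟺ `y ∈ 𝒪_c`; the depth clause at `μ = 1` ⟺ `y⁻¹ ∈ 𝒪_c`
  have hint' := forall_mem_forall_mem_v_herm_le_one_iff hρρ hvρ hα hα1 hint hΘΘ hΘρ hvΘ hc hc0 hc1 h hΛ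
  have hdep := forall_herm_mul_mem_iff_isOrd_div hρρ hvρ hα hα1 hint hΘΘ hΘρ hvΘ hc hc0 hc1 hh hx₀ hΛ (1 : K)
  constructor
  · intro hself
    have hyO : IsOrd ρ α c (dualGen ρ Θ α c h x₀) := by
      rw [IsOrd, dualGen_def]
      exact hint'.1 fun x hx x' hx' => (hself x').2 hx' x hx
    have hyinvO : IsOrd ρ α c (1 / dualGen ρ Θ α c h x₀) := hdep.1 fun b hb => by rw [one_mul]; exact (hself b).1 hb
    refine ⟨hyO, le_antisymm hyO.1 ?_⟩
    have h1 : Valued.v (1 / dualGen ρ Θ α c h x₀) ≤ 1 := hyinvO.1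
    rw [map_div₀, map_one, div_le_one₀ (zero_lt_iff.2 ((Valuation.ne_zero_iff _).2 hy0))] at h1
    exact h1
  · rintro ⟨hyO, hy1⟩ m
    constructor
    · intro hm
      have hyinvO : IsOrd ρ α c (1 / dualGen ρ Θ α c h x₀) := by
        rw [one_div]; exact isOrd_inv_of_v_eq_one hρρ hvρ hyO hy1
      have := hdep.2 hyinvO m hm
      rwa [one_mul] at this
    · intro hm a ha
      exact hint'.2 hyO a ha m hm

/-! ## §2 (W2) Self-dual = integral, Gram-primitive, level `0`; conductors are powers of `ϖE` -/

/-- `IsOrd` depends on the conductor only through its value. [cite: Flicker1998UnitaryFL, p. 84 REMARK] -/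
theorem isOrd_congr_of_v_eq {c c' : K} (hcc : Valued.v c = Valued.v c') (z : K) : IsOrd ρ α c z ↔ IsOrd ρ α c' z := by
  rw [IsOrd, IsOrd, map_mul, map_mul, hcc]

/-- **(W2)** With `0 < |ϖE| < 1`: `y ∈ 𝒪_c ∧ |y| = 1 ⟺ y ∈ 𝒪_c ∧ y∕ϖE ∉ 𝒪_c ∧ |y| = |ϖE|^0` (the level-`0`, Gram-primitive reading of self-duality). [cite: Jacobowitz1962, §7] -/
theorem isOrd_and_v_eq_one_iff_level_zero {ϖE : K} (hϖ0 : ϖE ≠ 0) (hϖ1 : Valued.v ϖE < 1) (c y : K) :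
    (IsOrd ρ α c y ∧ Valued.v y = 1) ↔ (IsOrd ρ α c y ∧ ¬ IsOrd ρ α c (y / ϖE) ∧ Valued.v y = Valued.v ϖE ^ 0) := by
  rw [pow_zero]
  constructor
  · rintro ⟨hyO, hy1⟩
    refine ⟨hyO, fun hdiv => ?_, hy1⟩
    have h1 : Valued.v (y / ϖE) ≤ 1 := hdiv.1
    rw [map_div₀, hy1, one_div, inv_le_one₀ (zero_lt_iff.2 ((Valuation.ne_zero_iff _).2 hϖ0))] at h1
    exact not_lt.2 h1 hϖ1
  · rintro ⟨hyO, -, hy1⟩; exact ⟨hyO, hy1⟩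

/-! ## §3 (W3) `lam`-stability and the conductor of an order lattice -/

/-- **`lam`-STABILITY IS `lam ∈ 𝒪_c`** for `Λ = x₀·𝒪_c` (★ `forall_mul_mem_iff_of_eq_mul_order`, restated in DEFS-leaf letters). [cite: Flicker1998UnitaryFL, p. 84 REMARK] -/
theorem forall_mul_mem_iff_isOrd (hvρ : ∀ x, Valued.v (ρ x) = Valued.v x) {Λ : AddSubgroup K} {x₀ c : K} (hx₀ : x₀ ≠ 0)
    (hΛ : ∀ x, x ∈ Λ ↔ ∃ z, IsOrd ρ α c z ∧ x = x₀ * z) (lam : K) :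
    (∀ x ∈ Λ, lam * x ∈ Λ) ↔ IsOrd ρ α c lam :=
  forall_mul_mem_iff_of_eq_mul_order hvρ hx₀ hΛ lam

/-- **THE CONDUCTOR IS DETERMINED UP TO VALUE**: if `x₀·𝒪_c = x₀′·𝒪_{c′}` (`x₀, x₀′ ≠ 0`, `|c|, |c′| ≤ 1`) then `|c| = |c′|` (both orders are the multiplier ring; test with `cα`,
`c′α`). [cite: Flicker1998UnitaryFL, p. 84 REMARK] -/
theorem v_conductor_eq_of_eq (hvρ : ∀ x, Valued.v (ρ x) = Valued.v x) (hα : ρ α ≠ α) (hα1 : Valued.v α ≤ 1)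
    (hint : ∀ z : K, Valued.v z ≤ 1 → Valued.v ((z - ρ z) / (α - ρ α)) ≤ 1)
    {Λ : AddSubgroup K} {x₀ x₀' c c' : K} (hx₀ : x₀ ≠ 0) (hx₀' : x₀' ≠ 0) (hc : ρ c = c) (hc1 : Valued.v c ≤ 1) (hc' : ρ c' = c') (hc1' : Valued.v c' ≤ 1)
    (hΛ : ∀ x, x ∈ Λ ↔ ∃ z, IsOrd ρ α c z ∧ x = x₀ * z) (hΛ' : ∀ x, x ∈ Λ ↔ ∃ z, IsOrd ρ α c' z ∧ x = x₀' * z) :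
    Valued.v c = Valued.v c' := by
  have hd : Valued.v (α - ρ α) ≠ 0 := (Valuation.ne_zero_iff _).2 (sub_ne_zero.2 (Ne.symm hα))
  have hmult : ∀ m, IsOrd ρ α c m ↔ IsOrd ρ α c' m := fun m => by
    rw [← forall_mul_mem_iff_isOrd hvρ hx₀ hΛ m, ← forall_mul_mem_iff_isOrd hvρ hx₀' hΛ' m]
  have key : ∀ {c₁ c₂ : K}, ρ c₁ = c₁ → Valued.v c₁ ≤ 1 → (∀ m, IsOrd ρ α c₁ m → IsOrd ρ α c₂ m) → Valued.v c₁ ≤ Valued.v c₂ := by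
    intro c₁ c₂ hc₁ hc₁1 himp
    have h1 : IsOrd ρ α c₁ (c₁ * α) := conductor_mul_alpha_mem_order hα hα1 hint hc₁ hc₁1
    have h2 := (himp _ h1).2
    rw [map_mul ρ, hc₁, ← mul_sub, map_mul, map_mul] at h2
    exact le_of_mul_le_mul_right h2 (zero_lt_iff.2 hd)
  exact le_antisymm (key hc hc1 fun m => (hmult m).1) (key hc' hc1' fun m => (hmult m).2)

/-- **LEVEL SETS OF DIFFERENT CONDUCTOR ARE DISJOINT** (`0 < |ϖE| < 1`, any levels `a, a′`). [cite: Flicker1998UnitaryFL, p. 84 REMARK] -/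
theorem eq_of_mem_levelSet_of_mem_levelSet (hvρ : ∀ x, Valued.v (ρ x) = Valued.v x) (hα : ρ α ≠ α) (hα1 : Valued.v α ≤ 1)
    (hint : ∀ z : K, Valued.v z ≤ 1 → Valued.v ((z - ρ z) / (α - ρ α)) ≤ 1)
    {ϖE : K} (hρϖ : ρ ϖE = ϖE) (hϖ0 : ϖE ≠ 0) (hϖ1 : Valued.v ϖE < 1) (h : K) {j j' a a' : ℕ} {Λ : AddSubgroup K}
    (hj : Λ ∈ levelSet ρ Θ α ϖE h j a) (hj' : Λ ∈ levelSet ρ Θ α ϖE h j' a') : j = j' := by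
  obtain ⟨x₀, hx₀, hΛ, -, -, -⟩ := hj
  obtain ⟨x₀', hx₀', hΛ', -, -, -⟩ := hj'
  have hρpow : ∀ n : ℕ, ρ (ϖE ^ n) = ϖE ^ n := fun n => by rw [map_pow, hρϖ]
  have hvpow : ∀ n : ℕ, Valued.v (ϖE ^ n) ≤ 1 := fun n => by rw [map_pow]; exact pow_le_one₀ zero_le hϖ1.le
  have hv := v_conductor_eq_of_eq hvρ hα hα1 hint hx₀ hx₀' (hρpow j) (hvpow j) (hρpow j') (hvpow j') hΛ hΛ'
  rw [map_pow, map_pow] at hv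
  exact (pow_right_injective₀ (zero_lt_iff.2 ((Valuation.ne_zero_iff _).2 hϖ0)) hϖ1.ne) hv

/-! ## §4 (W4) The W-side order census -/

/-- **(W4a) THE SET IDENTITY**: the `lam`-stable hermitian-self-dual ORDER LATTICES are the `lam`-stable members of the level-`0` sets, over all conductors `j`:
`{Λ | Λ = z·𝒪_c ∧ lamΛ ⊆ Λ ∧ Λ = Λ^#} = ⋃_j {Λ ∈ levelSet j 0 | lam ∈ 𝒪_{ϖE^j}}`. [cite: Kottwitz1986BaseChangeUnits, §1 pp. 240–241] [cite: Jacobowitz1962, §7] -/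
theorem setOf_orderLatt_selfDual_eq_iUnion (hρρ : ∀ x, ρ (ρ x) = x) (hvρ : ∀ x, Valued.v (ρ x) = Valued.v x) (hα : ρ α ≠ α) (hα1 : Valued.v α ≤ 1)
    (hint : ∀ z : K, Valued.v z ≤ 1 → Valued.v ((z - ρ z) / (α - ρ α)) ≤ 1)
    (hΘΘ : ∀ x, Θ (Θ x) = x) (hΘρ : ∀ x, Θ (ρ x) = ρ (Θ x)) (hvΘ : ∀ x, Valued.v (Θ x) = Valued.v x)
    {ϖE : K} (hρϖ : ρ ϖE = ϖE) (hϖ0 : ϖE ≠ 0) (hϖ1 : Valued.v ϖE < 1)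
    (hEval : ∀ c : K, ρ c = c → c ≠ 0 → Valued.v c ≤ 1 → ∃ n : ℕ, Valued.v c = Valued.v ϖE ^ n)
    {h : K} (hh : h ≠ 0) (lam : K) :
    {Λ : AddSubgroup K | (∃ z c : K, z ≠ 0 ∧ ρ c = c ∧ c ≠ 0 ∧ Valued.v c ≤ 1 ∧ ∀ x, x ∈ Λ ↔ ∃ y, IsOrd ρ α c y ∧ x = z * y) ∧
        (∀ x ∈ Λ, lam * x ∈ Λ) ∧ (∀ m, (∀ a ∈ Λ, Valued.v (h * Θ a * m + ρ (h * Θ a * m)) ≤ 1) ↔ m ∈ Λ)} =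
      ⋃ j : ℕ, {Λ | Λ ∈ levelSet ρ Θ α ϖE h j 0 ∧ IsOrd ρ α (ϖE ^ j) lam} := by
  have hρpow : ∀ n : ℕ, ρ (ϖE ^ n) = ϖE ^ n := fun n => by rw [map_pow, hρϖ]
  have hpow0 : ∀ n : ℕ, ϖE ^ n ≠ 0 := fun n => pow_ne_zero n hϖ0
  have hvpow : ∀ n : ℕ, Valued.v (ϖE ^ n) ≤ 1 := fun n => by rw [map_pow]; exact pow_le_one₀ zero_le hϖ1.le
  ext Λ
  simp only [Set.mem_setOf_eq, Set.mem_iUnion]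
  constructor
  · rintro ⟨⟨z, c, hz0, hc, hc0, hc1, hΛ⟩, hstab, hself⟩
    obtain ⟨j, hj⟩ := hEval c hc hc0 hc1
    have hcj : Valued.v c = Valued.v (ϖE ^ j) := by rw [hj, map_pow]
    -- re-read `Λ` with conductor `ϖE^j`
    have hΛj : ∀ x, x ∈ Λ ↔ ∃ y, IsOrd ρ α (ϖE ^ j) y ∧ x = z * y := fun x => by
      rw [hΛ x]; exact exists_congr fun y => by rw [isOrd_congr_of_v_eq hcj]
    have hsd := (forall_herm_iff_mem_iff_isOrd_and_v_eq_one hρρ hvρ hα hα1 hint hΘΘ hΘρ hvΘ (hρpow j) (hpow0 j) (hvpow j) hh hz0 hΛj).1 hself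
    have hlev := (isOrd_and_v_eq_one_iff_level_zero hϖ0 hϖ1 (ϖE ^ j) _).1 hsd
    exact ⟨j, ⟨z, hz0, hΛj, hlev.1, hlev.2.1, hlev.2.2⟩, (forall_mul_mem_iff_isOrd hvρ hz0 hΛj lam).1 hstab⟩
  · rintro ⟨j, ⟨z, hz0, hΛj, hyO, hyp, hyl⟩, hlam⟩
    have hsd := (isOrd_and_v_eq_one_iff_level_zero hϖ0 hϖ1 (ϖE ^ j) _).2 ⟨hyO, hyp, hyl⟩
    exact ⟨⟨z, ϖE ^ j, hz0, hρpow j, hpow0 j, hvpow j, hΛj⟩, (forall_mul_mem_iff_isOrd hvρ hz0 hΛj lam).2 hlam,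
      (forall_herm_iff_mem_iff_isOrd_and_v_eq_one hρρ hvρ hα hα1 hint hΘΘ hΘρ hvΘ (hρpow j) (hpow0 j) (hvpow j) hh hz0 hΛj).2 hsd⟩

/-- `lam ∉ 𝒪_{ϖE^j}` beyond some conductor propagates upward: if `lam ∉ 𝒪_{ϖE^{J+1}}` then `lam ∉ 𝒪_{ϖE^j}` for every `j > J` (the orders decrease with `j`).
[cite: Flicker1998UnitaryFL, p. 84 REMARK] -/
theorem not_isOrd_pow_of_lt {ϖE : K} (hϖ1 : Valued.v ϖE ≤ 1) {lam : K} {J : ℕ} (hJ : ¬ IsOrd ρ α (ϖE ^ (J + 1)) lam) {j : ℕ} (hj : J < j) :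
    ¬ IsOrd ρ α (ϖE ^ j) lam := by
  intro hj'
  apply hJ
  refine mem_order_mono ?_ hj'
  rw [map_pow, map_pow]
  exact pow_le_pow_right_of_le_one' hϖ1 hj

/-- **(W4) THE W-SIDE ORDER CENSUS.**  If the level-`0` sets are finite and `lam ∉ 𝒪_{ϖE^{J+1}}`, then
`#{Λ | Λ = z·𝒪_c ∧ lam·Λ ⊆ Λ ∧ Λ = Λ^#} = Σ_{j ≤ J} (if lam ∈ 𝒪_{ϖE^j} then #levelSet(j, 0) else 0)` — the AXIS TERM of the type-(2) block census read on the line model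
(★ T3-T (C)), in the rows `a = 0` of the T5 level tables. [cite: Kottwitz1986BaseChangeUnits, §1 pp. 240–241] [cite: Flicker1998UnitaryFL, p. 84 REMARK] [cite: Jacobowitz1962, §7] -/
theorem ncard_orderLatt_selfDual_eq_sum (hρρ : ∀ x, ρ (ρ x) = x) (hvρ : ∀ x, Valued.v (ρ x) = Valued.v x) (hα : ρ α ≠ α) (hα1 : Valued.v α ≤ 1)
    (hint : ∀ z : K, Valued.v z ≤ 1 → Valued.v ((z - ρ z) / (α - ρ α)) ≤ 1)
    (hΘΘ : ∀ x, Θ (Θ x) = x) (hΘρ : ∀ x, Θ (ρ x) = ρ (Θ x)) (hvΘ : ∀ x, Valued.v (Θ x) = Valued.v x)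
    {ϖE : K} (hρϖ : ρ ϖE = ϖE) (hϖ0 : ϖE ≠ 0) (hϖ1 : Valued.v ϖE < 1)
    (hEval : ∀ c : K, ρ c = c → c ≠ 0 → Valued.v c ≤ 1 → ∃ n : ℕ, Valued.v c = Valued.v ϖE ^ n)
    {h : K} (hh : h ≠ 0) (lam : K) {J : ℕ} (hJ : ¬ IsOrd ρ α (ϖE ^ (J + 1)) lam) (hfin : ∀ j, (levelSet ρ Θ α ϖE h j 0).Finite) :
    {Λ : AddSubgroup K | (∃ z c : K, z ≠ 0 ∧ ρ c = c ∧ c ≠ 0 ∧ Valued.v c ≤ 1 ∧ ∀ x, x ∈ Λ ↔ ∃ y, IsOrd ρ α c y ∧ x = z * y) ∧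
        (∀ x ∈ Λ, lam * x ∈ Λ) ∧ (∀ m, (∀ a ∈ Λ, Valued.v (h * Θ a * m + ρ (h * Θ a * m)) ≤ 1) ↔ m ∈ Λ)}.ncard =
      ∑ j ∈ Finset.range (J + 1), (if IsOrd ρ α (ϖE ^ j) lam then (levelSet ρ Θ α ϖE h j 0).ncard else 0) := by
  classical
  rw [setOf_orderLatt_selfDual_eq_iUnion hρρ hvρ hα hα1 hint hΘΘ hΘρ hvΘ hρϖ hϖ0 hϖ1 hEval hh lam]
  -- the pieces
  set S : ℕ → Set (AddSubgroup K) := fun j => {Λ | Λ ∈ levelSet ρ Θ α ϖE h j 0 ∧ IsOrd ρ α (ϖE ^ j) lam} with hS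
  have hSfin : ∀ j, (S j).Finite := fun j => (hfin j).subset fun Λ hΛ => hΛ.1
  have hSdisj : ∀ i j, i ≠ j → Disjoint (S i) (S j) := by
    intro i j hij
    rw [Set.disjoint_left]
    intro Λ hi hj
    exact hij (eq_of_mem_levelSet_of_mem_levelSet hvρ hα hα1 hint hρϖ hϖ0 hϖ1 h hi.1 hj.1)
  have hSempty : ∀ j, J < j → S j = ∅ := by
    intro j hj
    ext Λ
    simp only [hS, Set.mem_setOf_eq, Set.mem_empty_iff_false, iff_false, not_and]
    exact fun _ => not_isOrd_pow_of_lt hϖ1.le hJ hj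
  have hScard : ∀ j, (S j).ncard = if IsOrd ρ α (ϖE ^ j) lam then (levelSet ρ Θ α ϖE h j 0).ncard else 0 := by
    intro j
    split_ifs with hlam
    · congr 1; ext Λ; simp only [hS, Set.mem_setOf_eq, and_iff_left_iff_imp]; exact fun _ => hlam
    · rw [Set.ncard_eq_zero (hSfin j)]; ext Λ
      simp only [hS, Set.mem_setOf_eq, Set.mem_empty_iff_false, iff_false, not_and]; exact fun _ => hlam
  -- truncate the union at `J` and count by induction
  have hUnion : (⋃ j : ℕ, S j) = ⋃ j ∈ Finset.range (J + 1), S j := by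
    ext Λ
    simp only [Set.mem_iUnion, Finset.mem_range, exists_prop]
    constructor
    · rintro ⟨j, hj⟩
      refine ⟨j, ?_, hj⟩
      by_contra hJj
      have : S j = ∅ := hSempty j (by omega)
      rw [this] at hj; exact hj
    · rintro ⟨j, -, hj⟩; exact ⟨j, hj⟩
  rw [show (⋃ j : ℕ, {Λ | Λ ∈ levelSet ρ Θ α ϖE h j 0 ∧ IsOrd ρ α (ϖE ^ j) lam}) = ⋃ j : ℕ, S j from rfl, hUnion]
  have hgen : ∀ n : ℕ, (⋃ j ∈ Finset.range n, S j).ncard = ∑ j ∈ Finset.range n, (S j).ncard := by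
    intro n
    induction n with
    | zero => simp
    | succ n ih =>
      rw [Finset.range_add_one, Finset.sum_insert Finset.notMem_range_self, Finset.set_biUnion_insert]
      have hdisj : Disjoint (S n) (⋃ x ∈ Finset.range n, S x) := by
        rw [Set.disjoint_left]
        intro Λ hn hU
        simp only [Set.mem_iUnion, Finset.mem_range, exists_prop] at hU
        obtain ⟨j, hj, hΛj⟩ := hU
        exact (Set.disjoint_left.1 (hSdisj n j (by omega))) hn hΛj
      rw [Set.ncard_union_eq hdisj (hSfin n) ?_, ih]
      exact (Finset.range n).finite_toSet.biUnion fun j _ => hSfin j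
  rw [hgen]
  exact Finset.sum_congr rfl fun j _ => hScard j

end Summit.HodgeConjecture.HodgeConjecture.Cruxes.H413.F0P3cDyRamWSideOrderCensus

end
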